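import Summits.ABC.ABC.Theses.LogCardinality
import Summits.ABC.ABC.Theorems.LogCardinalitySubPowerStewartYuDichotomy
import HarnessLib

/-!
# Crux `SubPowerStewartYu` (stmt-ABC-11053) of route `LogCardinality` — PROVED

`Summits/ABC/ABC/Theorems/LogCardinalitySubPowerStewartYu.lean`: the sub-power refinement of
Stewart–Yu 2001 for ALL abc triples,

  `log c ≤ κ · R^{1/3} · exp(−c₀ log R / log log R)`  (`R = rad(abc) ≥ R₀`),

from the two inlined hypotheses of the crux: Pasten's form of the linear-forms bounds
(`PastenApproximationBound K`, both clauses) [cite: Pasten2024, Theorem 2.1] and Yu's 2013 `p`-adic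
bound over `ℚ` with constants weakened to `Aⁿ` [cite: Stewart2013, Lemma 5 (arXiv:1008.1274 p. 8)]
[cite: Yu2013, Main Theorem]. The proof is Stewart's inflation device [cite: Stewart2013, Lemma 8]
transplanted from `Φ_n(a,b)` to `a + b = c` inside the three-routes accounting of Stewart–Yu
[cite: StewartYu2001, Theorem 1], organised as a SLACK-OR-INFLATE dichotomy (helper files
`LogCardinalitySubPowerStewartYu{Routes,Family,Inflation,Analysis,Cases,Params,Top,Main,Dichotomy}`):
either the accounting's discarded slack already saves `exp(3c₁ log R/log log R)` (this covers the
near-primorial members of the crux's why-might-fail), or every member is top-heavy, has few primes,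
and the largest top prime `p* ≥ R^{1/4}` carries the inflated Yu bound with
`k = ⌊log p*/(C₂ log log p*)⌋` auxiliary primes, saving `e^{−3k}`. Constants: `Ā = max(|A|,1)`,
`C₂ = 64 Ā² e⁴`, `c₁ = 1/(144 C₂)`, `c₀ = c₁/2`.

WHAT THIS IS NOT: not abc, not a power saving (`BelowOneThird` is untouched); the hypotheses are
the crux's inlined statements, consumed by name-free unfolding (`intro`).
-/

noncomputable section

-- `Summit.ABC.ABC.…` is the tree's namespace convention for this sub-problem (summit = problem).
set_option linter.dupNamespace false

open Finset Real Height
open Literature.NumberTheory.DiophantineGeometry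
open Literature.NumberTheory.DiophantineGeometry.Dioph
open Literature.NumberTheory.DiophantineGeometry.Pasten
open Literature.Barriers.ABC

namespace Summit.ABC.ABC.Theorems

open SubPowerSY

/-- **From the cube bound to the sub-power bound** (cube root, self-improvement, and
`(log R)³ ≤ exp((c₁/2) log R / log log R)` for large `R`). [folklore] -/
theorem SubPowerSY.final_bound {K C C₂ R y : ℝ} (hK : 1 ≤ K) (hC : 1 ≤ C) (hC₂ : 1 ≤ C₂)
    (hRpos : 0 < R) (hR16 : 16 ≤ Real.log R)
    (hL₇ : 6 / (1 / (144 * C₂)) * Real.log (Real.log R) ^ 2 ≤ Real.log R)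
    (h : y ^ 3 ≤ 64 * K ^ 9 * C ^ 3 * max 1 (Real.log R) ^ 6 *
      Real.log (max (Real.exp 1) (2 * y)) ^ 3 * R *
      (Real.exp 3 * Real.exp (-(3 * (1 / (144 * C₂)) * Real.log R / Real.log (Real.log R))))) :
    y ≤ 64 * K ^ 3 * (C * Real.exp 1) * (Real.log (16 * K ^ 3 * (C * Real.exp 1)) + 3) *
      R ^ (1 / 3 : ℝ) * Real.exp (-(1 / (144 * C₂) / 2 * Real.log R / Real.log (Real.log R))) := by
  set L := Real.log R with hL
  set ℓ := Real.log L with hℓ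
  set c₁ : ℝ := 1 / (144 * C₂) with hc₁
  set E := Real.exp (c₁ * L / ℓ) with hE
  have hc₁pos : 0 < c₁ := by positivity
  have hc₁le : c₁ ≤ 1 / 3 := by
    rw [hc₁, div_le_div_iff₀ (by positivity) (by norm_num)]; linarith
  have hLpos : 0 < L := by linarith
  have hR0 : 0 < R := hRpos
  have hR2 : 2 ≤ R := by
    have h1 : Real.exp 16 ≤ R := by
      rw [← Real.exp_log hRpos]; exact Real.exp_le_exp.mpr hR16
    have h2 : (2 : ℝ) ≤ Real.exp 16 := by have := Real.add_one_le_exp (16 : ℝ); linarith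
    linarith
  have hlog16 : (2.76 : ℝ) ≤ Real.log 16 := by
    rw [show (16 : ℝ) = 2 ^ 4 by norm_num, Real.log_pow]; have := Real.log_two_gt_d9
    push_cast; linarith
  have hℓ276 : 2.76 ≤ ℓ := hlog16.trans (Real.log_le_log (by norm_num) hR16)
  have hℓpos : 0 < ℓ := by linarith
  have hE1 : 1 ≤ E := by
    rw [hE]; exact Real.one_le_exp_iff.mpr (by positivity)
  have hER : E ≤ R ^ (1 / 3 : ℝ) := by
    rw [hE, Real.rpow_def_of_pos hR0, Real.exp_le_exp, ← hL]
    have h1 : c₁ * L / ℓ ≤ c₁ * L := div_le_self (by positivity) (by linarith)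
    nlinarith
  -- rewrite the saving factor as `(e / E)³`-shape: `e³ e^{-3c₁L/ℓ} = (exp 1)³ / E³`
  have hfac : Real.exp 3 * Real.exp (-(3 * c₁ * L / ℓ)) = Real.exp 1 ^ 3 / E ^ 3 := by
    rw [hE, ← Real.exp_nat_mul, ← Real.exp_nat_mul, ← Real.exp_sub, ← Real.exp_add]
    push_cast; ring_nf
  have h' : y ^ 3 ≤ 64 * K ^ 9 * (C * Real.exp 1) ^ 3 * max 1 L ^ 6 *
      Real.log (max (Real.exp 1) (2 * y)) ^ 3 * R / E ^ 3 := by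
    calc y ^ 3 ≤ _ := h
      _ = 64 * K ^ 9 * (C * Real.exp 1) ^ 3 * max 1 L ^ 6 *
          Real.log (max (Real.exp 1) (2 * y)) ^ 3 * R / E ^ 3 := by
          rw [hfac]; ring
  have hCe : 1 ≤ C * Real.exp 1 := by
    have := Real.add_one_le_exp (1 : ℝ); nlinarith
  have key := le_of_cube_le_saving hK hCe hR2 hE1 hER h'
  -- `L³ / E ≤ exp(-(c₁/2) L / ℓ)`
  have hE0 : 0 < E := by positivity
  have hLE : L ^ 3 / E ≤ Real.exp (-(c₁ / 2 * L / ℓ)) := by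
    rw [div_le_iff₀ hE0, hE, ← Real.exp_add]
    have hL3 : L ^ 3 = Real.exp (3 * ℓ) := by
      rw [show (3 : ℝ) * ℓ = ((3 : ℕ) : ℝ) * ℓ by norm_num, Real.exp_nat_mul, hℓ, Real.exp_log hLpos]
    rw [hL3, Real.exp_le_exp]
    -- `3ℓ ≤ (c₁/2) L/ℓ`, i.e. `6 ℓ² ≤ c₁ L`
    have h6 : 6 / c₁ * ℓ ^ 2 ≤ L := hL₇
    rw [div_mul_eq_mul_div, div_le_iff₀ hc₁pos] at h6
    have : 3 * ℓ * ℓ ≤ c₁ / 2 * L := by nlinarith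
    have h7 : 3 * ℓ ≤ (c₁ / 2 * L) / ℓ := by rw [le_div_iff₀ hℓpos]; exact this
    have h8 : -(c₁ / 2 * L / ℓ) + c₁ * L / ℓ = (c₁ / 2 * L) / ℓ := by ring
    linarith
  have hκ0 : 0 ≤ 64 * K ^ 3 * (C * Real.exp 1) * (Real.log (16 * K ^ 3 * (C * Real.exp 1)) + 3) *
      R ^ (1 / 3 : ℝ) := by
    have hK3 : 1 ≤ K ^ 3 := one_le_pow₀ hK
    have : 0 ≤ Real.log (16 * K ^ 3 * (C * Real.exp 1)) := Real.log_nonneg (by nlinarith)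
    positivity
  calc y ≤ 64 * K ^ 3 * (C * Real.exp 1) * (Real.log (16 * K ^ 3 * (C * Real.exp 1)) + 3) *
        R ^ (1 / 3 : ℝ) * Real.log R ^ 3 / E := key
    _ = 64 * K ^ 3 * (C * Real.exp 1) * (Real.log (16 * K ^ 3 * (C * Real.exp 1)) + 3) *
        R ^ (1 / 3 : ℝ) * (L ^ 3 / E) := by rw [hL]; ring
    _ ≤ 64 * K ^ 3 * (C * Real.exp 1) * (Real.log (16 * K ^ 3 * (C * Real.exp 1)) + 3) *
        R ^ (1 / 3 : ℝ) * Real.exp (-(c₁ / 2 * L / ℓ)) := mul_le_mul_of_nonneg_left hLE hκ0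

/-- **Crux `SubPowerStewartYu` of route `ABC/LogCardinality` (stmt-ABC-11053).** For every
`K ≥ 1` such that Pasten's approximation bound holds at `K` (archimedean and `p`-adic clauses,
inlined) and every `A` such that Yu's 2013 `p`-adic bound over `ℚ` holds with constant `Aⁿ`
(inlined), there are `c₀ > 0`, `κ`, `R₀` with
`log c ≤ κ · rad(abc)^{1/3} · exp(−c₀ log rad / log log rad)` for every abc triple with
`rad(abc) ≥ R₀`. Proof: slack-or-inflate dichotomy in the three-routes accounting of Stewart–Yu 2001,
Stewart's 2013 inflation at the largest top prime (`SubPowerSY.cube_bound`), cube root and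
self-improvement (`SubPowerSY.final_bound`). [cite: StewartYu2001, Theorem 1]
[cite: Stewart2013, Lemma 8 (arXiv:1008.1274 pp. 9–10)] -/
theorem subPowerStewartYu_proof : Summit.ABC.ABC.Theses.LogCardinality.SubPowerStewartYu := by
  intro K A hK hP hYu
  classical
  -- constants
  have hK0 : (0 : ℝ) ≤ 4 * K ^ 2 := by positivity
  obtain ⟨C, hC1, hC⟩ := exists_prod_mul_log_sq_div_le hK0
  obtain ⟨D, hD1, hDJ⟩ := exists_prod_mul_log_sq_le_mul_sqrt_prod hK0
  obtain ⟨C₂, hC₂⟩ : ∃ C₂ : ℝ, C₂ = 64 * max |A| 1 ^ 2 * Real.exp 4 := ⟨_, rfl⟩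
  have hAb1 : 1 ≤ max |A| 1 := le_max_right _ _
  have he4 : (1 : ℝ) ≤ Real.exp 4 := by have := Real.add_one_le_exp (4 : ℝ); linarith
  have hC₂1 : 64 ≤ C₂ := by
    rw [hC₂]
    calc (64 : ℝ) = 64 * 1 * 1 := by norm_num
      _ ≤ 64 * max |A| 1 ^ 2 * Real.exp 4 :=
          mul_le_mul (mul_le_mul_of_nonneg_left (one_le_pow₀ hAb1) (by norm_num)) he4
            (by norm_num) (by positivity)
  have hC₂pos : 0 < C₂ := by linarith
  -- thresholds
  obtain ⟨x₂, hx₂⟩ := eventually_const_mul_log_sq_le (8 * C₂)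
  obtain ⟨u₀, hu₀⟩ := eventually_const_add_log_le
  obtain ⟨L₇, hL₇⟩ := eventually_const_mul_log_sq_le (6 / (1 / (144 * C₂)))
  obtain ⟨L₀, hL₀⟩ : ∃ L₀ : ℝ, L₀ = max (max (max 16 (4 * x₂)) (max (4 * u₀) L₇))
      (max (48 * Real.log D + 16) ((8 * C₂ * (2 + 6 * Real.log D)) ^ 2)) := ⟨_, rfl⟩
  have hlogD0 : 0 ≤ Real.log D := Real.log_nonneg hD1
  refine ⟨1 / (144 * C₂) / 2, by positivity,
    64 * K ^ 3 * (C * Real.exp 1) * (Real.log (16 * K ^ 3 * (C * Real.exp 1)) + 3),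
    Real.exp L₀, ?_⟩
  intro a b c h hR
  -- `L = log R ≥ L₀`
  set R : ℝ := ((rad a b c : ℕ) : ℝ) with hRdef
  have hR0 : 0 < R := lt_of_lt_of_le (Real.exp_pos L₀) hR
  have hL : L₀ ≤ Real.log R := by
    rw [← Real.log_exp L₀]; exact Real.log_le_log (Real.exp_pos L₀) hR
  have hL16 : 16 ≤ Real.log R := le_trans (by rw [hL₀]; simp) hL
  have hLx₂ : 4 * x₂ ≤ Real.log R := le_trans (by rw [hL₀]; simp) hL
  have hLu₀ : 4 * u₀ ≤ Real.log R := le_trans (by rw [hL₀]; simp) hL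
  have hLL₇ : L₇ ≤ Real.log R := le_trans (by rw [hL₀]; simp) hL
  have hLD : 48 * Real.log D + 16 ≤ Real.log R := le_trans (by rw [hL₀]; simp) hL
  have hLsq : (8 * C₂ * (2 + 6 * Real.log D)) ^ 2 ≤ Real.log R := le_trans (by rw [hL₀]; simp) hL
  have hLpos : 0 < Real.log R := by linarith
  -- the triple is not `1 + 1 = 2`
  obtain ⟨ha, hb, habc, hcop⟩ := id h
  have h1 : 1 < a * b := by
    by_contra hle
    push Not at hle
    have hab : a * b = 1 := le_antisymm hle (Nat.mul_pos ha hb)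
    have ha1 : a = 1 := Nat.eq_one_of_mul_eq_one_right hab
    have hb1 : b = 1 := Nat.eq_one_of_mul_eq_one_left hab
    have hc2 : c = 2 := by omega
    have : R = 2 := by
      rw [hRdef, ha1, hb1, hc2, rad_one_one_two]; norm_num
    have h2 : Real.log 2 < 0.6931471808 := Real.log_two_lt_d9
    rw [this] at hL16; linarith
  -- the largeness conditions of `cube_bound`
  have hc2 : ∀ x : ℝ, Real.log R / 4 ≤ x → 8 * C₂ * Real.log x ^ 2 ≤ x :=
    fun x hx => hx₂ x (by linarith)
  have hc3 : ∀ x : ℝ, Real.log R / 4 ≤ x → 6 + Real.log x ≤ 0.001 * x :=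
    fun x hx => hu₀ x (by linarith)
  have hc4 : 2 + 6 * Real.log D ≤ Real.log R / (8 * C₂ * Real.log (Real.log R)) := by
    have hℓpos : 0 < Real.log (Real.log R) := Real.log_pos (by linarith)
    have hsqrt : Real.log (Real.log R) ≤ Real.sqrt (Real.log R) := log_le_sqrt hLpos.le
    have hs0 : 0 < Real.sqrt (Real.log R) := Real.sqrt_pos.mpr hLpos
    -- `√L ≥ 8 C₂ (2 + 6 log D)`
    have h1' : 8 * C₂ * (2 + 6 * Real.log D) ≤ Real.sqrt (Real.log R) := by
      rw [show 8 * C₂ * (2 + 6 * Real.log D) = Real.sqrt ((8 * C₂ * (2 + 6 * Real.log D)) ^ 2) by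
        rw [Real.sqrt_sq (by positivity)]]
      exact Real.sqrt_le_sqrt hLsq
    rw [le_div_iff₀ (by positivity)]
    calc (2 + 6 * Real.log D) * (8 * C₂ * Real.log (Real.log R))
        ≤ (2 + 6 * Real.log D) * (8 * C₂ * Real.sqrt (Real.log R)) := by
          apply mul_le_mul_of_nonneg_left _ (by positivity)
          exact mul_le_mul_of_nonneg_left hsqrt (by positivity)
      _ = (8 * C₂ * (2 + 6 * Real.log D)) * Real.sqrt (Real.log R) := by ring
      _ ≤ Real.sqrt (Real.log R) * Real.sqrt (Real.log R) :=
          mul_le_mul_of_nonneg_right h1' hs0.le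
      _ = Real.log R := Real.mul_self_sqrt hLpos.le
  have hc5 : 48 * Real.log D ≤ Real.log R := by linarith
  have hcube := SubPowerSY.cube_bound hK hP hYu hC1 hC hC₂ hD1 hDJ h h1 hL16 hc2 hc3 hc4 hc5
  have hL₇' : 6 / (1 / (144 * C₂)) * Real.log (Real.log R) ^ 2 ≤ Real.log R := hL₇ _ hLL₇
  exact SubPowerSY.final_bound hK hC1 (by linarith) hR0 hL16 hL₇' hcube

end Summit.ABC.ABC.Theorems

end
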